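import Literature.NumberTheory.Rogawski1990.ArchBouazizWallSurjectiveAssembly   -- ★ p851574 (W4): `bzLocalSurjWall_of_parts`
import Literature.NumberTheory.Rogawski1990.ArchBouazizWallClassMultiple        -- ★ p851576 (W12-asm): `wallGerm_classMultiple_of_parts`, `compactRH_ne_zero_of_mem_regS`; brings ★ (W0) `ArchBouazizClassMapWallTube`, ★ closed range
import HarnessLib

/-!
# BOUAZIZ'S SURJECTIVITY AT A WALL BASE CLASS FROM THE THREE REMAINING BRICKS: `hwall` of ★ `bouazizSurjOfForward_of_parts` from (W1′) zero-jump gluing, (W2c) class realisation at a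
# fibre point, (W3-asm) the generator package — over ★ (W0) class tubes, ★ (W4) the filtration assembly, ★ (W12-asm) the class-multiple glue
# (Bouaziz 1994 ASENS 27 §4 proof of Thm 4.1.1, §5.1–5.2 pp. 588–590, Thm. 6.2.1 (i) p. 592; Shelstad 1979 §4 Thm. 4.7)

Topic `NumberTheory/Rogawski1990`; namespace `Literature.NumberTheory.Rogawski1990`.  THEOREMS ONLY (no `def`, no instance, no notation, no axiom, no named fact, no `sorry`; one
`private` radius helper).  Cell `pub/hodgecm-mathlib`, crux H413 (`stmt-HodgeConjecture-24833`), line LH3 (closer stub `stub_N9`, DIRECT ROAD), letter L3′, organ O-L3′-S-WALL = the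
`hwall` binder of ★ p851480∕p851508 (LH10-p01 (g5)); brick (W5-pre) of the W-ROAD (LH3-p01 (g6), census 6129001bfae4ccc0, dealer RULING #26).  Author LH3-p01 (g6).  Lane
`--kind proof --supports stmt-HodgeConjecture-24833`.  Count-neutral.

WHAT.  `bzLocalSurjWall_of_bricks`: the FULL text of `hwall` —
`∀ b, (∃ w, (b w).1² = 4 (b w).2.1) → ∃ ε > 0, ∀ Ψ ∈ ArchBouazizSpaceH jcH, ∃ fH ∈ C_c^∞(H_∞), stOrbFamH νH fH S c = Ψ S c` for `c ∈ RegS S`, `dist (bzClassMap S c) b < ε` —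
from the forward half `hfwd` and SIX universally quantified brick texts: the frame facts (F1) chart types near `b`, (F2) fibre points ON the walls with their regularity off `Z(b)`,
(F3) tube regularity off `Z(b)` (LH1-p03 (g7), (W5-frame) `ArchBouazizWallFrame`), (W1′) zero-jump gluing in tube currency (LH7-p04 (g6)), (W2c) class realisation at one fibre point in
the order «∀ δ, ∃ δ′, ∀ G» (F0P3a-p06 (g20) ⊕ A-p12 (g28)), and (W3-asm) the generator package (F0P3a-p08 (g24) over LH3-p02's (W3-G) and F0P3a-p09's (W3-T)).  The payer (W5) is then
`bzLocalSurjWall_of_bricks L νH jcH hfwd ‹F1› ‹F2› ‹F3› ‹W1′› ‹W2c› ‹W3-asm›` by bare names.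
PROOF.  Off the (closed, ★ p851511) class images the statement is vacuous with `fH := 0`.  On them, `b = bzClassMap S_b c_b`; with `Z := {t² = 4d}`, `S₀ := S_b ∖ Z` and the level
normaliser `Q T c := ∏_{w ∉ S₀ ∪ T} (1 − e^{i(c_{w,2} − c_{w,0})})` feed ★ `bzLocalSurjWall_of_parts`: `hW0` = (F1), `hQ` = ★ `compactRH_ne_zero_of_mem_regS`, `hW12` = ★
`wallGerm_classMultiple_of_parts` at the chart `S₀ ∪ T` with `P := Z ∖ T` and the fibre point of (F2) (its (W1′)∕(W2c) hypotheses are the bricks; `S₀ ∪ insert w T = insert w (S₀ ∪ T)`),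
`hGen` = (W3-asm).
HONEST LABEL: L3′ stays «S-road organ-complete modulo (Σ-WALL) PRINT» until (W1′), (W2c), (W3-asm), (W5-frame) are ★ and the payer lands; HC_CM is proved only modulo the 7 printed citations
(2 remaining: hLiu418 = stmt-HodgeConjecture-24832, h413 = stmt-HodgeConjecture-24833) until rung 0 closes; this file is an assembly and pays nothing by itself.

## References
* [Bouaziz1994IntegralesOrbitales] A. Bouaziz, *Intégrales orbitales sur les groupes de Lie réductifs*, Ann. Sci. ÉNS (4) 27 (1994) 573–609, §4 pp. 585–586, §5.1–5.2 pp. 588–590,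
  Thm. 6.2.1 (i) p. 592.
* [Shelstad1979] D. Shelstad, *Characters and inner forms of a quasi-split group over ℝ*, Compositio Math. 39 (1979), §4 Thm. 4.7 p. 31.
-/

set_option autoImplicit false

noncomputable section

open MeasureTheory NumberField NumberField.InfinitePlace Complex Set Function Filter Topology
open Literature.NumberTheory.Automorphic Literature.NumberTheory.Automorphic.UnitaryGroup Literature.NumberTheory.Automorphic.ArchCartan
open scoped Classical ContDiff Topology

namespace Literature.NumberTheory.Rogawski1990

/-- A positive number below a positive number attached to each member of a finite set. [folklore] -/
private theorem exists_pos_le_forall_of_finset' {ι : Type*} (s : Finset ι) {δ : ι → ℝ} (hδ : ∀ i ∈ s, 0 < δ i) : ∃ ε : ℝ, 0 < ε ∧ ∀ i ∈ s, ε ≤ δ i := by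
  classical
  induction s using Finset.induction_on with
  | empty => exact ⟨1, one_pos, fun i hi => absurd hi (Finset.notMem_empty i)⟩
  | insert a s ha ih =>
    obtain ⟨ε, hε, hεs⟩ := ih fun i hi => hδ i (Finset.mem_insert_of_mem hi)
    refine ⟨min ε (δ a), lt_min hε (hδ a (Finset.mem_insert_self a s)), fun i hi => ?_⟩
    rcases Finset.mem_insert.1 hi with rfl | hi
    · exact min_le_right _ _
    · exact (min_le_left _ _).trans (hεs i hi)

section Bricks

variable (L : Type) [Field L] [NumberField L] [IsCMField L]
  [MeasurableSpace (↥(arch (↥(maximalRealSubfield L)) L (IsCMField.complexConj L) 2 (Matrix.of fun i j : Fin 2 => if i.val + j.val + 1 = 2 then (1 : L) else 0)) ×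
      ↥(arch (↥(maximalRealSubfield L)) L (IsCMField.complexConj L) 1 (Matrix.of fun i j : Fin 1 => if i.val + j.val + 1 = 1 then (1 : L) else 0)))]
  [BorelSpace (↥(arch (↥(maximalRealSubfield L)) L (IsCMField.complexConj L) 2 (Matrix.of fun i j : Fin 2 => if i.val + j.val + 1 = 2 then (1 : L) else 0)) ×
      ↥(arch (↥(maximalRealSubfield L)) L (IsCMField.complexConj L) 1 (Matrix.of fun i j : Fin 1 => if i.val + j.val + 1 = 1 then (1 : L) else 0)))]
  (νH : Measure (↥(arch (↥(maximalRealSubfield L)) L (IsCMField.complexConj L) 2 (Matrix.of fun i j : Fin 2 => if i.val + j.val + 1 = 2 then (1 : L) else 0)) ×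
      ↥(arch (↥(maximalRealSubfield L)) L (IsCMField.complexConj L) 1 (Matrix.of fun i j : Fin 1 => if i.val + j.val + 1 = 1 then (1 : L) else 0))))
  [IsFiniteMeasureOnCompacts νH] [νH.IsMulRightInvariant]

/-- **BOUAZIZ'S SURJECTIVITY AT A WALL BASE CLASS, FROM THE BRICKS** — the `hwall` organ of ★ `bouazizSurjOfForward_of_parts`, all base classes at once, from the forward half and the
six universally quantified brick texts (F1) `hF1`, (F2) `hF2`, (F3) `hF3`, (W1′) `hW1`, (W2c) `hW2`, (W3-asm) `hGen` (see the module docstring for who types which); over ★ (W4)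
`bzLocalSurjWall_of_parts`, ★ (W12-asm) `wallGerm_classMultiple_of_parts`, ★ (W0) class tubes and ★ closed class images.  `Z(b)` is the inline predicate `(b w).1 ^ 2 = 4 * (b w).2.1`
throughout. [cite: Bouaziz1994IntegralesOrbitales, §4 pp. 585–586; §5.1 p. 588; Thm. 6.2.1 (i) p. 592] [cite: Shelstad1979, Thm. 4.7 (p. 31)] -/
theorem bzLocalSurjWall_of_bricks (jcH : Finset {w : InfinitePlace L // IsComplex w} → {w : InfinitePlace L // IsComplex w} → ℂ)
    (hfwd : ∀ fH : ↥(arch (↥(maximalRealSubfield L)) L (IsCMField.complexConj L) 2 (Matrix.of fun i j : Fin 2 => if i.val + j.val + 1 = 2 then (1 : L) else 0)) ×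
      ↥(arch (↥(maximalRealSubfield L)) L (IsCMField.complexConj L) 1 (Matrix.of fun i j : Fin 1 => if i.val + j.val + 1 = 1 then (1 : L) else 0)) → ℂ,
      ArchSmooth₂ L fH → ArchBouazizSpaceH jcH (stOrbFamH L νH fH))
    -- (F1) chart types near `b`
    (hF1 : ∀ (b : {w : InfinitePlace L // IsComplex w} → ℂ × ℂ × ℂ) (S_b : Finset {w : InfinitePlace L // IsComplex w}) (c_b : {w : InfinitePlace L // IsComplex w} → Fin 3 → ℝ),
      bzClassMap S_b c_b = b → ∃ ε₀ : ℝ, 0 < ε₀ ∧ ∀ (S : Finset {w : InfinitePlace L // IsComplex w}) (c : {w : InfinitePlace L // IsComplex w} → Fin 3 → ℝ),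
        c ∈ RegS S → dist (bzClassMap S c) b < ε₀ →
          S \ Finset.univ.filter (fun w => (b w).1 ^ 2 = 4 * (b w).2.1) = S_b.filter (fun w => (b w).1 ^ 2 ≠ 4 * (b w).2.1))
    -- (F2) fibre points on the walls, regular off `Z(b)`
    (hF2 : ∀ (b : {w : InfinitePlace L // IsComplex w} → ℂ × ℂ × ℂ) (S_b : Finset {w : InfinitePlace L // IsComplex w}) (c_b : {w : InfinitePlace L // IsComplex w} → Fin 3 → ℝ),
      bzClassMap S_b c_b = b → ∀ T, T ⊆ Finset.univ.filter (fun w => (b w).1 ^ 2 = 4 * (b w).2.1) →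
        ∃ c_T : {w : InfinitePlace L // IsComplex w} → Fin 3 → ℝ,
          bzClassMap (S_b.filter (fun w => (b w).1 ^ 2 ≠ 4 * (b w).2.1) ∪ T) c_T = b ∧
          (∀ w, w ∉ S_b.filter (fun w => (b w).1 ^ 2 ≠ 4 * (b w).2.1) ∪ T → (b w).1 ^ 2 = 4 * (b w).2.1 → c_T w 0 = c_T w 2) ∧
          (∀ w ∈ T, c_T w 0 = 0) ∧
          (∀ w ∈ S_b.filter (fun w => (b w).1 ^ 2 ≠ 4 * (b w).2.1) ∪ T, w ∉ T → c_T w 0 ≠ 0) ∧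
          (∀ w, w ∉ S_b.filter (fun w => (b w).1 ^ 2 ≠ 4 * (b w).2.1) ∪ T → (b w).1 ^ 2 ≠ 4 * (b w).2.1 → Circle.exp (c_T w 0) ≠ Circle.exp (c_T w 2)))
    -- (F3) tube regularity off `Z(b)`
    (hF3 : ∀ (b : {w : InfinitePlace L // IsComplex w} → ℂ × ℂ × ℂ), ∃ ε₁ : ℝ, 0 < ε₁ ∧ ∀ (S : Finset {w : InfinitePlace L // IsComplex w}) (c : {w : InfinitePlace L // IsComplex w} → Fin 3 → ℝ),
      dist (bzClassMap S c) b < ε₁ → ∀ w, w ∉ S → (b w).1 ^ 2 ≠ 4 * (b w).2.1 → Circle.exp (c w 0) ≠ Circle.exp (c w 2))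
    -- (W1′) zero-jump gluing in tube currency
    (hW1 : ∀ (S : Finset {w : InfinitePlace L // IsComplex w}) (b : {w : InfinitePlace L // IsComplex w} → ℂ × ℂ × ℂ) (ε : ℝ), 0 < ε →
      (∀ c : {w : InfinitePlace L // IsComplex w} → Fin 3 → ℝ, dist (bzClassMap S c) b < ε → ∀ w, w ∉ S → (b w).1 ^ 2 ≠ 4 * (b w).2.1 → Circle.exp (c w 0) ≠ Circle.exp (c w 2)) →
      ∀ D : Finset {w : InfinitePlace L // IsComplex w} → ({w : InfinitePlace L // IsComplex w} → Fin 3 → ℝ) → ℂ, ArchBouazizSpaceH jcH D →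
        (∀ w, w ∉ S → (b w).1 ^ 2 = 4 * (b w).2.1 → ∀ c, c ∈ RegS (insert w S) → dist (bzClassMap (insert w S) c) b < ε → D (insert w S) c = 0) →
        ∃ G : ({w : InfinitePlace L // IsComplex w} → Fin 3 → ℝ) → ℂ, ContDiffOn ℝ ∞ G {c | dist (bzClassMap S c) b < ε} ∧
          ∀ c, c ∈ InRegS S → dist (bzClassMap S c) b < ε → G c = archERho S c * D S c)
    -- (W2c) class realisation at ONE fibre point, «∀ δ, ∃ δ′, ∀ G»
    (hW2 : ∀ (S P T : Finset {w : InfinitePlace L // IsComplex w}) (c₀ : {w : InfinitePlace L // IsComplex w} → Fin 3 → ℝ),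
      (∀ w ∈ P, w ∉ S) → T ⊆ S → (∀ w ∈ P, c₀ w 0 = c₀ w 2) → (∀ w ∈ T, c₀ w 0 = 0) → (∀ w ∈ S, w ∉ T → c₀ w 0 ≠ 0) →
      (∀ w, w ∉ S → w ∉ P → Circle.exp (c₀ w 0) ≠ Circle.exp (c₀ w 2)) →
      ∀ δ : ℝ, 0 < δ → ∃ δ' : ℝ, 0 < δ' ∧ ∀ G : ({w : InfinitePlace L // IsComplex w} → Fin 3 → ℝ) → ℂ, ContDiffOn ℝ ∞ G (Metric.ball c₀ δ) →
        (∀ w ∈ P, ∀ c ∈ Metric.ball c₀ δ, G (flipAt w c) = -G c) → (∀ w ∈ T, ∀ c ∈ Metric.ball c₀ δ, G (negXAt w c) = G c) →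
        ∃ U : ({w : InfinitePlace L // IsComplex w} → ℂ × ℂ × ℂ) → ℂ, ContDiff ℝ ∞ U ∧
          ∀ c ∈ Metric.ball c₀ δ', G c = (∏ w ∈ Finset.univ \ S, (2 * I * (Real.sin ((c w 0 - c w 2) / 2) : ℂ))) * U (bzClassMap S c))
    -- (W3-asm) the generator package
    (hGen : ∀ (b : {w : InfinitePlace L // IsComplex w} → ℂ × ℂ × ℂ) (S_b : Finset {w : InfinitePlace L // IsComplex w}) (c_b : {w : InfinitePlace L // IsComplex w} → Fin 3 → ℝ),
      bzClassMap S_b c_b = b → ∀ T, T ⊆ Finset.univ.filter (fun w => (b w).1 ^ 2 = 4 * (b w).2.1) →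
      ∃ g : ↥(arch (↥(maximalRealSubfield L)) L (IsCMField.complexConj L) 2 (Matrix.of fun i j : Fin 2 => if i.val + j.val + 1 = 2 then (1 : L) else 0)) ×
        ↥(arch (↥(maximalRealSubfield L)) L (IsCMField.complexConj L) 1 (Matrix.of fun i j : Fin 1 => if i.val + j.val + 1 = 1 then (1 : L) else 0)) → ℂ,
        ArchSmooth₂ L g ∧
        (∃ ε : ℝ, 0 < ε ∧ ∀ T', T' ⊆ Finset.univ.filter (fun w => (b w).1 ^ 2 = 4 * (b w).2.1) → ¬ T' ⊆ T →
          ∀ c, c ∈ RegS (S_b.filter (fun w => (b w).1 ^ 2 ≠ 4 * (b w).2.1) ∪ T') →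
            dist (bzClassMap (S_b.filter (fun w => (b w).1 ^ 2 ≠ 4 * (b w).2.1) ∪ T') c) b < ε →
            stOrbFamH L νH g (S_b.filter (fun w => (b w).1 ^ 2 ≠ 4 * (b w).2.1) ∪ T') c = 0) ∧
        ∃ (c₀ : {w : InfinitePlace L // IsComplex w} → Fin 3 → ℝ) (v : ℂ), bzClassMap (S_b.filter (fun w => (b w).1 ^ 2 ≠ 4 * (b w).2.1) ∪ T) c₀ = b ∧
          c₀ ∈ closure (RegS (S_b.filter (fun w => (b w).1 ^ 2 ≠ 4 * (b w).2.1) ∪ T)) ∧ v ≠ 0 ∧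
          Tendsto (fun c => stOrbFamH L νH g (S_b.filter (fun w => (b w).1 ^ 2 ≠ 4 * (b w).2.1) ∪ T) c /
            ∏ w, (if w ∈ S_b.filter (fun w => (b w).1 ^ 2 ≠ 4 * (b w).2.1) ∪ T then (1 : ℂ) else (1 - (Circle.exp (c w 2 - c w 0) : ℂ))))
            (𝓝[RegS (S_b.filter (fun w => (b w).1 ^ 2 ≠ 4 * (b w).2.1) ∪ T)] c₀) (𝓝 v)) :
    ∀ b : {w : InfinitePlace L // IsComplex w} → ℂ × ℂ × ℂ, (∃ w, (b w).1 ^ 2 = 4 * (b w).2.1) →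
      ∃ ε : ℝ, 0 < ε ∧ ∀ Ψ : Finset {w : InfinitePlace L // IsComplex w} → ({w : InfinitePlace L // IsComplex w} → Fin 3 → ℝ) → ℂ, ArchBouazizSpaceH jcH Ψ →
        ∃ fH : ↥(arch (↥(maximalRealSubfield L)) L (IsCMField.complexConj L) 2 (Matrix.of fun i j : Fin 2 => if i.val + j.val + 1 = 2 then (1 : L) else 0)) ×
          ↥(arch (↥(maximalRealSubfield L)) L (IsCMField.complexConj L) 1 (Matrix.of fun i j : Fin 1 => if i.val + j.val + 1 = 1 then (1 : L) else 0)) → ℂ,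
          ArchSmooth₂ L fH ∧ ∀ (S : Finset {w : InfinitePlace L // IsComplex w}) (c : {w : InfinitePlace L // IsComplex w} → Fin 3 → ℝ),
            c ∈ RegS S → dist (bzClassMap S c) b < ε → stOrbFamH L νH fH S c = Ψ S c := by
  intro b _
  by_cases hrange : ∃ (S_b : Finset {w : InfinitePlace L // IsComplex w}) (c_b : {w : InfinitePlace L // IsComplex w} → Fin 3 → ℝ), bzClassMap S_b c_b = b
  swap
  · -- off every (closed) class image: a ball around `b` meets no chart, the statement is vacuous with `fH := 0`
    push Not at hrange
    have hδ : ∀ S : Finset {w : InfinitePlace L // IsComplex w}, ∃ δ : ℝ, 0 < δ ∧ ∀ c : {w : InfinitePlace L // IsComplex w} → Fin 3 → ℝ, δ ≤ dist (bzClassMap S c) b := by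
      intro S
      have hopen : IsOpen (Set.range (bzClassMap S : ({w : InfinitePlace L // IsComplex w} → Fin 3 → ℝ) → _))ᶜ := (isClosed_range_bzClassMap S).isOpen_compl
      have hb : b ∈ (Set.range (bzClassMap S : ({w : InfinitePlace L // IsComplex w} → Fin 3 → ℝ) → _))ᶜ := fun ⟨c, hc⟩ => hrange S c hc
      obtain ⟨δ, hδ, hball⟩ := Metric.isOpen_iff.1 hopen b hb
      refine ⟨δ, hδ, fun c => le_of_not_gt fun hlt => hball ?_ ⟨c, rfl⟩⟩
      rw [Metric.mem_ball]; exact hlt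
    choose δ hδ hδle using hδ
    obtain ⟨ε, hε, hεle⟩ := exists_pos_le_forall_of_finset' (Finset.univ : Finset (Finset {w : InfinitePlace L // IsComplex w})) (δ := δ) fun S _ => hδ S
    refine ⟨ε, hε, fun Ψ _ => ⟨0, archSmooth₂_zero L, fun S c _ hd => ?_⟩⟩
    exact absurd ((hεle S (Finset.mem_univ S)).trans (hδle S c)) (not_le.2 hd)
  -- on the class images
  obtain ⟨S_b, c_b, hcb⟩ := hrange
  set Z : Finset {w : InfinitePlace L // IsComplex w} := Finset.univ.filter (fun w => (b w).1 ^ 2 = 4 * (b w).2.1) with hZdef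
  set S₀ : Finset {w : InfinitePlace L // IsComplex w} := S_b.filter (fun w => (b w).1 ^ 2 ≠ 4 * (b w).2.1) with hS₀def
  have hmemZ : ∀ w, w ∈ Z ↔ (b w).1 ^ 2 = 4 * (b w).2.1 := fun w => by simp [hZdef]
  have hmemS₀ : ∀ w, w ∈ S₀ ↔ w ∈ S_b ∧ (b w).1 ^ 2 ≠ 4 * (b w).2.1 := fun w => by simp [hS₀def]
  obtain ⟨ε₁, hε₁, hreg₁⟩ := hF3 b
  refine bzLocalSurjWall_of_parts L νH jcH hfwd b Z S₀
    (fun T c => ∏ w, (if w ∈ S₀ ∪ T then (1 : ℂ) else (1 - (Circle.exp (c w 2 - c w 0) : ℂ))))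
    (hF1 b S_b c_b hcb) (fun T _ c hc => compactRH_ne_zero_of_mem_regS (S₀ ∪ T) hc) (fun T hT ε hε => ?_) (fun T hT => hGen b S_b c_b hcb T hT)
  -- `hW12` at the chart `S₀ ∪ T`, `P := Z \ T`
  obtain ⟨c_T, hcT, hcTP, hcTT, hSreg, hCreg⟩ := hF2 b S_b c_b hcb T hT
  have hPS : ∀ w ∈ Z \ T, w ∉ S₀ ∪ T := by
    intro w hw hw'
    rw [Finset.mem_sdiff] at hw
    rcases Finset.mem_union.1 hw' with h | h
    · exact ((hmemS₀ w).1 h).2 ((hmemZ w).1 hw.1)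
    · exact hw.2 h
  have hTS : T ⊆ S₀ ∪ T := Finset.subset_union_right
  -- membership bookkeeping: off `S₀ ∪ T`, «not in `Z \ T`» = «not central»
  have hoffP : ∀ w, w ∉ S₀ ∪ T → (w ∉ Z \ T ↔ (b w).1 ^ 2 ≠ 4 * (b w).2.1) := by
    intro w hw
    have hwT : w ∉ T := fun h => hw (Finset.mem_union_right _ h)
    rw [Finset.mem_sdiff, not_and_or, hmemZ]
    constructor
    · rintro (h | h)
      · exact h
      · exact absurd hwT h
    · exact fun h => Or.inl h
  have hcTP' : ∀ w ∈ Z \ T, c_T w 0 = c_T w 2 := fun w hw => hcTP w (hPS w hw) ((hmemZ w).1 (Finset.mem_sdiff.1 hw).1)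
  have hCreg' : ∀ w, w ∉ S₀ ∪ T → w ∉ Z \ T → Circle.exp (c_T w 0) ≠ Circle.exp (c_T w 2) := fun w hw hwP => hCreg w hw ((hoffP w hw).1 hwP)
  have hreg₁' : ∀ c : {w : InfinitePlace L // IsComplex w} → Fin 3 → ℝ, dist (bzClassMap (S₀ ∪ T) c) b < ε₁ →
      ∀ w, w ∉ S₀ ∪ T → w ∉ Z \ T → Circle.exp (c w 0) ≠ Circle.exp (c w 2) :=
    fun c hc w hw hwP => hreg₁ (S₀ ∪ T) c hc w hw ((hoffP w hw).1 hwP)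
  -- (W1′) in the shape ★ `wallGerm_classMultiple_of_parts` expects
  have hW1' : ∀ ε : ℝ, 0 < ε → (∀ c : {w : InfinitePlace L // IsComplex w} → Fin 3 → ℝ, dist (bzClassMap (S₀ ∪ T) c) b < ε → ∀ w, w ∉ S₀ ∪ T → w ∉ Z \ T → Circle.exp (c w 0) ≠ Circle.exp (c w 2)) →
      ∀ D : Finset {w : InfinitePlace L // IsComplex w} → ({w : InfinitePlace L // IsComplex w} → Fin 3 → ℝ) → ℂ, ArchBouazizSpaceH jcH D →
        (∀ w ∈ Z \ T, ∀ c, c ∈ RegS (insert w (S₀ ∪ T)) → dist (bzClassMap (insert w (S₀ ∪ T)) c) b < ε → D (insert w (S₀ ∪ T)) c = 0) →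
        ∃ G : ({w : InfinitePlace L // IsComplex w} → Fin 3 → ℝ) → ℂ, ContDiffOn ℝ ∞ G {c | dist (bzClassMap (S₀ ∪ T) c) b < ε} ∧
          ∀ c, c ∈ InRegS (S₀ ∪ T) → dist (bzClassMap (S₀ ∪ T) c) b < ε → G c = archERho (S₀ ∪ T) c * D (S₀ ∪ T) c := by
    intro ε' hε' hregP D hD hvanP
    refine hW1 (S₀ ∪ T) b ε' hε' (fun c hc w hw hnc => hregP c hc w hw ((hoffP w hw).2 hnc)) D hD fun w hw hzc => hvanP w ?_
    exact Finset.mem_sdiff.2 ⟨(hmemZ w).2 hzc, fun h => hw (Finset.mem_union_right _ h)⟩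
  obtain ⟨ε', hε', hmain⟩ := wallGerm_classMultiple_of_parts jcH (S₀ ∪ T) (Z \ T) T b hPS hTS hcT hcTP' hcTT hε₁ hreg₁' hW1'
    (hW2 (S₀ ∪ T) (Z \ T) T c_T hPS hTS hcTP' hcTT hSreg hCreg') hε
  refine ⟨ε', hε', fun D hD hvan => hmain D hD fun w hw c hc hd => ?_⟩
  -- `insert w (S₀ ∪ T) = S₀ ∪ insert w T`
  have hwZ : w ∈ Z := (Finset.mem_sdiff.1 hw).1
  have hwT : w ∉ T := (Finset.mem_sdiff.1 hw).2
  have heq : insert w (S₀ ∪ T) = S₀ ∪ insert w T := by rw [Finset.union_insert]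
  rw [heq] at hc hd ⊢
  exact hvan w hwZ hwT c hc hd

end Bricks

end Literature.NumberTheory.Rogawski1990

end
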